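import Literature.Analysis.Convexity.PrekopaLeindler
import HarnessLib

/-!
# The Brunn–Minkowski inequality in `ℝⁿ`

Topic `Literature/Analysis/Convexity`. Fully proved (no named facts), on top of the tree's proved
Prékopa–Leindler inequality (`PrekopaLeindler.lean`, `prekopaLeindler`).

* `volume_rpow_mul_volume_rpow_le` — the MULTIPLICATIVE Brunn–Minkowski inequality
  `vol(A)^{1-s} vol(B)^s ≤ vol(C)` whenever `(1-s)A + sB ⊆ C` (`0 < s < 1`; `A, B, C` measurable):
  Prékopa–Leindler applied to the three indicator functions [Gardner 2002, §7, (20)–(22)].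
* `brunnMinkowski_pow` — the homogeneity step [Gardner 2002, §4, proof that (12) ⇒ (11)]:
  if `a^n ≤ vol A` and `b^n ≤ vol B` (`a, b ≥ 0`, `A, B` nonempty measurable with `A + B`
  measurable) then `(a + b)^n ≤ vol(A + B)` — apply the multiplicative form to `a⁻¹A`, `b⁻¹B` with
  `s = b/(a+b)`, whose `s`-combination is `(a+b)⁻¹(A + B)`.
* `brunnMinkowski` — the Brunn–Minkowski inequality [Gardner 2002, Thm 4.1 in the form (11) "with
  the coefficients `s` and `t` omitted"]: `vol(A)^{1/n} + vol(B)^{1/n} ≤ vol(A + B)^{1/n}` (`n ≠ 0`)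
  for nonempty measurable `A, B ⊆ ℝⁿ` with `A + B` measurable; `brunnMinkowski_of_isCompact` — the
  same for nonempty compact sets (no measurability side conditions).

Everything is stated for Lebesgue measure `volume` on `EuclideanSpace ℝ (Fin n)`, in `ℝ≥0∞`.
Not here: the convex-combination form (10) (immediate from (11) by homogeneity), equality cases,
non-measurable sums (Gardner §10).

## References
* R. J. Gardner, *The Brunn–Minkowski inequality*, Bull. Amer. Math. Soc. 39 (2002) 355–405,
  Theorem 4.1, (10)–(12), §7 (20)–(22). [`Gardner2002`]
* H. J. Brascamp, E. H. Lieb, J. Funct. Anal. 22 (1976) 366–389 (Prékopa–Leindler, Thm 3.3 —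
  the tree's `prekopaLeindler`). [`BrascampLieb1976`]
-/

noncomputable section

open Set Filter
open _root_.MeasureTheory _root_.MeasureTheory.Measure
open scoped ENNReal NNReal Pointwise Topology

namespace Literature.Analysis.Convexity

variable {n : ℕ}

/-- **Multiplicative Brunn–Minkowski inequality.** For `0 < s < 1` and measurable
`A, B, C ⊆ ℝⁿ` with `(1 - s)A + sB ⊆ C`: `vol(A)^{1-s} · vol(B)^s ≤ vol(C)`.  (Prékopa–Leindler for
the indicator functions `1_A, 1_B, 1_C`: the hypothesis `1_C((1-s)x + sy) ≥ 1_A(x)^{1-s} 1_B(y)^s`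
is the inclusion.) [cite: Gardner2002, §7 (22)] -/
theorem volume_rpow_mul_volume_rpow_le {s : ℝ} (hs0 : 0 < s) (hs1 : s < 1)
    {A B C : Set (EuclideanSpace ℝ (Fin n))} (hA : MeasurableSet A) (hB : MeasurableSet B)
    (hC : MeasurableSet C) (hsub : (1 - s) • A + s • B ⊆ C) :
    volume A ^ (1 - s) * volume B ^ s ≤ volume C := by
  have key := prekopaLeindler hs0 hs1 (f := A.indicator 1) (g := B.indicator 1)
    (h := C.indicator 1) (measurable_one.indicator hA) (measurable_one.indicator hB)
    (measurable_one.indicator hC) ?_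
  · rwa [lintegral_indicator_one hA, lintegral_indicator_one hB, lintegral_indicator_one hC] at key
  · intro x y
    by_cases hx : x ∈ A
    · by_cases hy : y ∈ B
      · have hz : (1 - s) • x + s • y ∈ C :=
          hsub (Set.add_mem_add (Set.smul_mem_smul_set hx) (Set.smul_mem_smul_set hy))
        simp [Set.indicator_of_mem, hx, hy, hz]
      · simp [Set.indicator_of_notMem, hy, ENNReal.zero_rpow_of_pos hs0]
    · simp [Set.indicator_of_notMem, hx, ENNReal.zero_rpow_of_pos (sub_pos.2 hs1)]

/-- A translate of `B` by a point of `A` lies in `A + B`, so `vol B ≤ vol(A + B)`. [folklore] -/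
private theorem volume_le_volume_add_left {A B : Set (EuclideanSpace ℝ (Fin n))}
    (hAne : A.Nonempty) : volume B ≤ volume (A + B) := by
  obtain ⟨x, hx⟩ := hAne
  calc volume B = volume (x +ᵥ B) := (measure_vadd volume x B).symm
    _ ≤ volume (A + B) := by
        refine measure_mono ?_
        rintro _ ⟨y, hy, rfl⟩
        exact Set.add_mem_add hx hy

/-- Symmetrically, `vol A ≤ vol(A + B)` for `B` nonempty. [folklore] -/
private theorem volume_le_volume_add_right {A B : Set (EuclideanSpace ℝ (Fin n))}
    (hBne : B.Nonempty) : volume A ≤ volume (A + B) := by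
  rw [add_comm]
  exact volume_le_volume_add_left hBne

/-- Volume of a dilate: `vol(r • A) = |r|ⁿ vol(A)` on `ℝⁿ`. [folklore] -/
private theorem volume_smul_eq (r : ℝ) (A : Set (EuclideanSpace ℝ (Fin n))) :
    volume (r • A) = ENNReal.ofReal (|r| ^ n) * volume A := by
  rw [Measure.addHaar_smul, finrank_euclideanSpace_fin, abs_pow]

/-- **Brunn–Minkowski, homogeneous form.** If `A, B ⊆ ℝⁿ` are nonempty and measurable with
`A + B` measurable, and `a, b ≥ 0` satisfy `aⁿ ≤ vol A`, `bⁿ ≤ vol B`, then `(a + b)ⁿ ≤ vol(A + B)`.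
(Gardner's deduction of (11) from (12)/(22): apply the multiplicative inequality to `a⁻¹A` and
`b⁻¹B`, of volume `≥ 1`, with `s = b/(a+b)`; then `(1-s)a⁻¹A + s b⁻¹B = (a+b)⁻¹(A + B)` has volume
`≥ 1`.) [cite: Gardner2002, Thm 4.1 and §4, (11)–(12)] -/
theorem brunnMinkowski_pow {A B : Set (EuclideanSpace ℝ (Fin n))} (hA : MeasurableSet A)
    (hB : MeasurableSet B) (hAB : MeasurableSet (A + B)) (hAne : A.Nonempty) (hBne : B.Nonempty)
    {a b : ℝ} (ha : 0 ≤ a) (hb : 0 ≤ b) (hvA : ENNReal.ofReal (a ^ n) ≤ volume A)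
    (hvB : ENNReal.ofReal (b ^ n) ≤ volume B) :
    ENNReal.ofReal ((a + b) ^ n) ≤ volume (A + B) := by
  rcases ha.eq_or_lt with rfl | ha
  · rw [zero_add]
    exact hvB.trans (volume_le_volume_add_left hAne)
  rcases hb.eq_or_lt with rfl | hb
  · rw [add_zero]
    exact hvA.trans (volume_le_volume_add_right hBne)
  have hab : 0 < a + b := add_pos ha hb
  -- the exponent `s = b/(a+b)`
  set s : ℝ := b / (a + b) with hs
  have hs0 : 0 < s := div_pos hb hab
  have hs1 : s < 1 := (div_lt_one hab).2 (by linarith)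
  have h1s : 1 - s = a / (a + b) := by
    rw [hs]; field_simp; ring
  -- normalised sets of volume `≥ 1`
  have hvA' : 1 ≤ volume (a⁻¹ • A) := by
    rw [volume_smul_eq, abs_of_pos (inv_pos.2 ha)]
    calc (1 : ℝ≥0∞) = ENNReal.ofReal (a⁻¹ ^ n) * ENNReal.ofReal (a ^ n) := by
          rw [← ENNReal.ofReal_mul (pow_nonneg (inv_pos.2 ha).le _), ← mul_pow,
            inv_mul_cancel₀ ha.ne', one_pow, ENNReal.ofReal_one]
      _ ≤ ENNReal.ofReal (a⁻¹ ^ n) * volume A := by gcongr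
  have hvB' : 1 ≤ volume (b⁻¹ • B) := by
    rw [volume_smul_eq, abs_of_pos (inv_pos.2 hb)]
    calc (1 : ℝ≥0∞) = ENNReal.ofReal (b⁻¹ ^ n) * ENNReal.ofReal (b ^ n) := by
          rw [← ENNReal.ofReal_mul (pow_nonneg (inv_pos.2 hb).le _), ← mul_pow,
            inv_mul_cancel₀ hb.ne', one_pow, ENNReal.ofReal_one]
      _ ≤ ENNReal.ofReal (b⁻¹ ^ n) * volume B := by gcongr
  -- the `s`-combination of the normalised sets is `(a+b)⁻¹ (A + B)`
  have hcomb : (1 - s) • (a⁻¹ • A) + s • (b⁻¹ • B) = (a + b)⁻¹ • (A + B) := by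
    rw [smul_smul, smul_smul, h1s, hs, smul_add]
    congr 1
    · rw [div_mul_eq_mul_div, mul_inv_cancel₀ ha.ne', one_div]
    · rw [div_mul_eq_mul_div, mul_inv_cancel₀ hb.ne', one_div]
  have hmult := volume_rpow_mul_volume_rpow_le hs0 hs1 (hA.const_smul₀ a⁻¹)
    (hB.const_smul₀ b⁻¹) (hAB.const_smul₀ (a + b)⁻¹) hcomb.subset
  have hone : (1 : ℝ≥0∞) ≤ volume ((a + b)⁻¹ • (A + B)) := by
    calc (1 : ℝ≥0∞) = 1 ^ (1 - s) * 1 ^ s := by rw [ENNReal.one_rpow, ENNReal.one_rpow, one_mul]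
      _ ≤ volume (a⁻¹ • A) ^ (1 - s) * volume (b⁻¹ • B) ^ s :=
          mul_le_mul' (ENNReal.rpow_le_rpow hvA' (by linarith)) (ENNReal.rpow_le_rpow hvB' hs0.le)
      _ ≤ volume ((a + b)⁻¹ • (A + B)) := hmult
  rw [volume_smul_eq, abs_of_pos (inv_pos.2 hab)] at hone
  calc ENNReal.ofReal ((a + b) ^ n) = ENNReal.ofReal ((a + b) ^ n) * 1 := (mul_one _).symm
    _ ≤ ENNReal.ofReal ((a + b) ^ n) * (ENNReal.ofReal ((a + b)⁻¹ ^ n) * volume (A + B)) := by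
        gcongr
    _ = volume (A + B) := by
        rw [← mul_assoc, ← ENNReal.ofReal_mul (pow_nonneg hab.le _), ← mul_pow,
          mul_inv_cancel₀ hab.ne', one_pow, ENNReal.ofReal_one, one_mul]

/-- **The Brunn–Minkowski inequality in `ℝⁿ`** (`n ≠ 0`): for nonempty measurable `A, B ⊆ ℝⁿ`
with `A + B` measurable, `vol(A)^{1/n} + vol(B)^{1/n} ≤ vol(A + B)^{1/n}`.
[cite: Gardner2002, Thm 4.1, (11)] -/
theorem brunnMinkowski (hn : n ≠ 0) {A B : Set (EuclideanSpace ℝ (Fin n))}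
    (hA : MeasurableSet A) (hB : MeasurableSet B) (hAB : MeasurableSet (A + B))
    (hAne : A.Nonempty) (hBne : B.Nonempty) :
    volume A ^ (n⁻¹ : ℝ) + volume B ^ (n⁻¹ : ℝ) ≤ volume (A + B) ^ (n⁻¹ : ℝ) := by
  have hn0 : (0 : ℝ) < (n⁻¹ : ℝ) := by positivity
  -- infinite volumes: the right-hand side is `⊤`
  by_cases hAt : volume A = ⊤
  · have : volume (A + B) = ⊤ := eq_top_iff.2 (hAt ▸ volume_le_volume_add_right hBne)
    rw [this, ENNReal.top_rpow_of_pos hn0]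
    exact le_top
  by_cases hBt : volume B = ⊤
  · have : volume (A + B) = ⊤ := eq_top_iff.2 (hBt ▸ volume_le_volume_add_left hAne)
    rw [this, ENNReal.top_rpow_of_pos hn0]
    exact le_top
  -- finite volumes: `a = vol(A)^{1/n}`, `b = vol(B)^{1/n}` as real numbers
  set a : ℝ := (volume A).toReal ^ (n⁻¹ : ℝ) with ha_def
  set b : ℝ := (volume B).toReal ^ (n⁻¹ : ℝ) with hb_def
  have ha : 0 ≤ a := Real.rpow_nonneg ENNReal.toReal_nonneg _
  have hb : 0 ≤ b := Real.rpow_nonneg ENNReal.toReal_nonneg _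
  have han : ENNReal.ofReal (a ^ n) = volume A := by
    rw [ha_def, Real.rpow_inv_natCast_pow ENNReal.toReal_nonneg hn, ENNReal.ofReal_toReal hAt]
  have hbn : ENNReal.ofReal (b ^ n) = volume B := by
    rw [hb_def, Real.rpow_inv_natCast_pow ENNReal.toReal_nonneg hn, ENNReal.ofReal_toReal hBt]
  have hpow := brunnMinkowski_pow hA hB hAB hAne hBne ha hb han.le hbn.le
  have hroot := ENNReal.rpow_le_rpow hpow hn0.le
  rw [ENNReal.ofReal_rpow_of_nonneg (pow_nonneg (add_nonneg ha hb) _) hn0.le,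
    Real.pow_rpow_inv_natCast (add_nonneg ha hb) hn, ENNReal.ofReal_add ha hb] at hroot
  have hA' : ENNReal.ofReal a = volume A ^ (n⁻¹ : ℝ) := by
    rw [ha_def, ← ENNReal.ofReal_rpow_of_nonneg ENNReal.toReal_nonneg hn0.le,
      ENNReal.ofReal_toReal hAt]
  have hB' : ENNReal.ofReal b = volume B ^ (n⁻¹ : ℝ) := by
    rw [hb_def, ← ENNReal.ofReal_rpow_of_nonneg ENNReal.toReal_nonneg hn0.le,
      ENNReal.ofReal_toReal hBt]
  rwa [hA', hB'] at hroot

/-- **Brunn–Minkowski for compact sets** (`n ≠ 0`): for nonempty compact `A, B ⊆ ℝⁿ`,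
`vol(A)^{1/n} + vol(B)^{1/n} ≤ vol(A + B)^{1/n}` (here `A + B` is compact, so all three sets are
measurable). [cite: Gardner2002, Thm 4.1, (11)] -/
theorem brunnMinkowski_of_isCompact (hn : n ≠ 0) {A B : Set (EuclideanSpace ℝ (Fin n))}
    (hA : IsCompact A) (hB : IsCompact B) (hAne : A.Nonempty) (hBne : B.Nonempty) :
    volume A ^ (n⁻¹ : ℝ) + volume B ^ (n⁻¹ : ℝ) ≤ volume (A + B) ^ (n⁻¹ : ℝ) :=
  brunnMinkowski hn hA.measurableSet hB.measurableSet (hA.add hB).measurableSet hAne hBne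

/-- **Brunn–Minkowski for compact sets, homogeneous form**: for nonempty compact `A, B ⊆ ℝⁿ` and
`a, b ≥ 0` with `aⁿ ≤ vol A`, `bⁿ ≤ vol B`: `(a + b)ⁿ ≤ vol(A + B)`.
[cite: Gardner2002, Thm 4.1, (11)] -/
theorem brunnMinkowski_pow_of_isCompact {A B : Set (EuclideanSpace ℝ (Fin n))}
    (hA : IsCompact A) (hB : IsCompact B) (hAne : A.Nonempty) (hBne : B.Nonempty)
    {a b : ℝ} (ha : 0 ≤ a) (hb : 0 ≤ b) (hvA : ENNReal.ofReal (a ^ n) ≤ volume A)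
    (hvB : ENNReal.ofReal (b ^ n) ≤ volume B) :
    ENNReal.ofReal ((a + b) ^ n) ≤ volume (A + B) :=
  brunnMinkowski_pow hA.measurableSet hB.measurableSet (hA.add hB).measurableSet hAne hBne ha hb
    hvA hvB

end Literature.Analysis.Convexity

end
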